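import Mathlib
import HarnessLib
import HarnessLib.Audit
import Summits.Langlands.Statement
import HarnessLib.Audit.Status.Attr

/-!
Route: MirrorPairReflection

# Route MirrorPairReflection — two Ribet lattices + cyclotomic reflection — even
residually-reducible conductor-p^∞ GL₂/ℚ is void off mirror irregular pairs, dihedral at AAC primes

Gen-2 conforming re-opening of the line of card
Langlands/Langlands/conductor-one-mirror-irregular-pairs (route-Langlands-MirrorIrregularPairs
was retired 2026-08-15 `not-a-thesis` only because its assembly stopped at the sector target; every
item below was route-reviewed rc0 with a
paper audit, and this route adds the deciding theorem `closes … : _root_.Langlands`, PROVED in the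
planner folder with the classification
derived from the cruxes inside the proof). Sector served: direction (B) of the summit for n = 2, F =
ℚ, conductor p^∞, EVEN ρ with REDUCIBLE
residue — where (B) holds by being (nearly) vacuous and Taylor–Wiles has no traction. It suffices to
show X = EvenReducibleResidueClassification:
for every odd prime p, every continuous σ : Γ_ℚ → GL₂(ℚ̄_p) unramified outside p, of residual type
ω^a ⊕ ω^b (by traces:
‖tr σ(g) − χ_p(g)^a − χ_p(g)^b‖ < 1 ∀ g) and even (a+b even ⟺ det σ(c) = +1), is REDUCIBLE — unless
p ≡ 1 (mod 4), (b−a) ≡ (p−1)/2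
(mod p−1), p ∣ B_{(p−1)/2} (an Ankeny–Artin–Chowla counterexample prime; none < 2·10^11) and σ is
diagonal on Γ_{ℚ(√p)} (a twist of an even
dihedral Artin representation). Given X, the support item SectorComplement (X → Langlands: the
honest name for the rest of the summit) closes.
Lean: `∀ (p : ℕ) [Fact p.Prime], p ≠ 2 → ∀ (σ :
Literature.NumberTheory.GaloisRepresentations.FramedGaloisRep ℚ (PadicAlgCl p) 2) (a b : ℕ), (∀ v :
IsDedekindDomain.HeightOneSpectrum (NumberField.RingOfIntegers ℚ), ((p : ℕ) :
NumberField.RingOfIntegers ℚ) ∉ v.asIdeal → σ.IsUnramifiedAt v) → Even (a + b) → (∀ g :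
Field.absoluteGaloisGroup ℚ, ‖Literature.NumberTheory.GaloisRepresentations.FramedRep.trace σ g -
((algebraMap ℚ_[p] (PadicAlgCl p)
(((Literature.NumberTheory.GaloisRepresentations.GaloisRep.cyclotomicCharacter ℚ p g : ℤ_[p]ˣ) :
ℤ_[p]) : ℚ_[p])) ^ a + (algebraMap ℚ_[p] (PadicAlgCl p)
(((Literature.NumberTheory.GaloisRepresentations.GaloisRep.cyclotomicCharacter ℚ p g : ℤ_[p]ˣ) :
ℤ_[p]) : ℚ_[p])) ^ b)‖ < 1) → Literature.NumberTheory.GaloisRepresentations.FramedRep.IsIrreducible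
σ → p % 4 = 1 ∧ 2 * (((b : ℤ) - a) % ((p : ℤ) - 1)).toNat = p - 1 ∧ ((p : ℤ) ∣ (bernoulli ((p - 1) /
2)).num) ∧ (∃ (P : Matrix.GeneralLinearGroup (Fin 2) (PadicAlgCl p)) (r : AlgebraicClosure ℚ), r ^ 2
= (p : AlgebraicClosure ℚ) ∧ ∀ g : Field.absoluteGaloisGroup ℚ, g • r = r → ((P * σ g * P⁻¹ :
Matrix.GeneralLinearGroup (Fin 2) (PadicAlgCl p)) : Matrix (Fin 2) (Fin 2) (PadicAlgCl p)) 0 1 = 0 ∧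
((P * σ g * P⁻¹ : Matrix.GeneralLinearGroup (Fin 2) (PadicAlgCl p)) : Matrix (Fin 2) (Fin 2)
(PadicAlgCl p)) 1 0 = 0)`

## Assembly
The deciding theorem (folder SketchGlue.lean / glue.lean; lean check rc 0, 0 sorries, axioms
propext/Classical.choice/Quot.sound) is
`closes (hK : KummerHerbrandSplitting) (hM : MirrorCriterion) (hN : NonSelfMirrorReducible) (hS :
SelfMirrorDihedral) (hR : ScalarResidueReducible)
(hC : SectorComplement) : _root_.Langlands := hC (classification)`, where `classification :
EvenReducibleResidueClassification` is DERIVED INSIDE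
THE PROOF from the cruxes (≈ 45 tactic lines): given σ even of type (a,b), irreducible: if (p−1) ∣
(b−a), ScalarResidueReducible contradicts
irreducibility; else MirrorCriterion (fed KummerHerbrandSplitting) yields p ∣ B_m ∧ p ∣ B_(p−1−m);
if ¬ (p−1) ∣ 2(b−a), NonSelfMirrorReducible
contradicts; else Int.emod arithmetic gives 2m = p−1 (m = (b−a) mod (p−1) is a positive multiple of
(p−1)/2 below p−1), parity of a+b and of
p−1 gives m even hence p ≡ 1 (mod 4), the Bernoulli index is rewritten to (p−1)/2, and
SelfMirrorDihedral supplies the dihedral clause. The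
Assembly item below is literally the type of `closes`, hence provable at once (`theorem
Assembly_holds : Assembly := closes`). Target reachability (rev 3, badge repair):
the support item CruxesToClassification : KummerHerbrandSplitting → MirrorCriterion →
NonSelfMirrorReducible → SelfMirrorDihedral →
ScalarResidueReducible → EvenReducibleResidueClassification states that same case analysis as an
ITEM, so that X is concluded by an item of the
route and the chain reads cruxes → X (CruxesToClassification) → Statement (SectorComplement); it is
provable at once (planner folder
Sketch.lean: lean check rc 0, 0 sorries — the body of `closes` after `refine hC ?_`). `closes`
itself is unchanged.

Rationale: WHY THIS LINE. ENGINE (MirrorCriterion): if σ as above is irreducible with a ≢ b, BOTH endpoint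
lattices of Ribet's segment (Ribet1976 Prop. 2.1; Bellaïche's
tree version, BellaicheChenevier2009 §1.5–1.7) reduce to NON-SPLIT triangular representations,
giving non-zero classes in H¹(G_{ℚ,{p,∞}}, ω^{±(b−a)});
for an EVEN exponent j ≢ 0 Kummer theory over ℚ(μ_p) identifies h¹(ω^j) with the p-rank of the ODD
eigenspace Cl(ℚ(μ_p))(ω^{1−j}) (no local
condition at p, no unit contribution, no Vandiver; Lang1990 Ch. 6 §1, Washington1997 Thm 10.9) and
Herbrand (Stickelberger; Lang1990 Ch. 1 §3
Cor. 3) gives p ∣ B_j; hence p ∣ B_m AND p ∣ B_{p−1−m}, m = (b−a) mod (p−1): a MIRROR IRREGULAR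
PAIR. Imported: classical cyclotomic arithmetic
(Kummer, Herbrand/Stickelberger, Leopoldt reflection, Ankeny–Artin–Chowla) and Ribet–Bellaïche
lattice geometry, pointed at the even half of
level-one Fontaine–Mazur where potential automorphy is useless by design (Calegari2011 needs
irreducible residue; Berger2018 Prop. 2 / Khare
print only ONE lattice + splitting at p + Vandiver ⟹ odd; SkinnerWiles1999 / Pan2022 need oddness).
The same G_{ℚ,{p}}-cohomology is run
FORWARD in Greenberg2016 and Ray2021 (arXiv:2012.08122, Lemma 3.2 / Thm 3.3: parity 'k_i − k_j odd'
makes every root character odd and the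
problem unobstructed) to CONSTRUCT odd open-image representations; read contrapositively in the
even-difference world, where both Ext groups
are class-group-sized, it becomes an unconditional, table-checkable necessary condition. What
remains open is isolated as two rigidity
cruxes at the primes the criterion cannot exclude (genuine mirror pairs: none < 8192; AAC primes:
none < 2·10^11). Negatives index
(1 entry, K3 Kuga–Satake) is not touched.

RANKED CRUXES. #0 EvenReducibleResidueClassification (target) — X as in § Thesis — classification of
the even, residually reducible, conductor-p^∞ sector of (B) for GL₂/ℚ, p odd: reducible, or (p ≡ 1
mod 4, self-mirror index, p ∣ B_((p−1)/2), and σ diagonal on Γ_ℚ(√p)). Typing: residual type by the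
trace congruence (n = 2 < p, so traces give σ̄^ss), evenness as Even (a+b), dihedral as simultaneous
diagonalisability on the stabiliser of a square root r of p in ℚ̄. (why it might fail: Only through
NonSelfMirrorReducible / SelfMirrorDihedral: an isolated irreducible even point of an
expected-dimension-0 deformation ring at a genuine mirror pair (none < 8192) or an AAC prime (none <
2·10^11); elsewhere MirrorCriterion + ScalarResidueReducible give it outright.) [Berger2018,
Calegari2011, Ribet1976, AnkenyArtinChowla1952, Greenberg2016, Ray2021]
#2 NonSelfMirrorReducible (crux) — RIGIDITY AT A GENUINE MIRROR PAIR (card M2 as a statement; the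
open residue of the sector): p odd, σ : Γ_ℚ → GL₂(ℚ̄_p) continuous, unramified outside p, residual
type (a,b), a+b even, m := (b−a) mod (p−1) ∉ {0, (p−1)/2} (typed ¬ (p−1) ∣ 2(b−a)), and p ∣ B_m ∧ p
∣ B_(p−1−m) (the only case MirrorCriterion leaves, so the divisibilities are hypotheses). CLAIM: σ
is reducible — no even 2-dimensional p-adic representation of conductor p^∞ with infinite
(necessarily non-dihedral) image has reducible non-scalar residue. For: no ARTIN σ has this type (a
finite subgroup of GL₂(ℤ̄_p) reducing into a Borel with distinct characters is P⋊C; an irreducible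
plane forces the dihedral shape m = (p−1)/2); the even deformation ring of the non-split residual
extension has expected relative dimension h¹(ad⁰) − h²(ad⁰) = 0 (complex conjugation acts trivially
on ad), tangent directions governed by McCallum–Sharifi cup products of cyclotomic p-units; no
instance below 8192 (gen-0 planner power-sum scan, refuter scan < 1100, evidence on the old items
stmt-Langlands-3230/3253), ≈ 0.3–0.8 genuine mirror pairs expected below 2^31 (HartHarveyOng2017
tables). [deps: MirrorCriterion] [difficulty: open-problem] (why it might fail: Expected dimension 0
does not force emptiness: at a mirror pair both root characters ω^(±m) occur in Gal(M/ℚ(μ_p))^ab/p —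
the input of the Greenberg2016 / Ray2021 open-image constructions — and only the relations (h² = r_p
≥ 2) can forbid an isolated even open-image σ.) [Greenberg2016, Ray2021, MccallumSharifi2003,
Ramakrishna1998, Calegari2011, BellaicheChenevier2009, HartHarveyOng2017]
#3 MirrorCriterion (support, rank 3 — re-badged crux→support by the 2026-08-15 retriage: no failure
regime given its hypothesis, the provable-now engine, staff first among support) — MIRROR CRITERION
(card M1, normalisations pinned; hypothesis = verbatim the support item KummerHerbrandSplitting, so
that this item is exactly the NEW combination and is provable now): p odd, σ : Γ_ℚ → GL₂(ℚ̄_p)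
continuous, IRREDUCIBLE, unramified outside p, residual type (a,b) with a+b even and a ≢ b (mod
p−1); m := (b−a) mod (p−1) ∈ {2,4,…,p−3}. THEN p ∣ B_m AND p ∣ B_(p−1−m). Proof plan: (i) σ(Γ_ℚ) ⊂
GL₂(E), E/ℚ_p finite (compact image + Baire), stable lattice (tree: exists_integralModel),
reduction; the trace congruence gives σ̄^ss = ω^a ⊕ ω^b (n = 2 < p); (ii) Ribet1976 Prop. 2.1 /
Bellaïche: σ irreducible, ω^a ≠ ω^b ⟹ the stable lattices up to homothety form a SEGMENT whose two
ENDPOINTS reduce to the non-split shapes (ω^a *; 0 ω^b) and (ω^b *; 0 ω^a), continuous, unramified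
outside p; (iii) KummerHerbrandSplitting (contrapositive) at each endpoint: p ∣ B_((a−b) mod (p−1))
= B_(p−1−m) and p ∣ B_m. No hypothesis at p (σ need not be de Rham), no Vandiver. Sanity (37; 32):
type (0,32) would need 37 ∣ B_4 — false — so no irreducible σ of that type exists although the
non-split residual extension does. [deps: KummerHerbrandSplitting] [difficulty: L] (why it might
fail: Mathematically only an index slip (the two endpoints are Kummer-dual to two DIFFERENT odd
eigenspaces; audited on paper by the rc0 route review); formally the descent ℚ̄_p → finite E, BOTH
Ribet endpoint lattices and 'trace congruence ⟹ σ̄^ss' are absent from the tree; novelty risk: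
folklore.) [Ribet1976, BellaicheChenevier2009, Berger2018, arXiv:1611.09315, Lang1990,
Washington1997]
#4 SelfMirrorDihedral (crux) — THE SELF-MIRROR INDEX m = (p−1)/2 IS DIHEDRAL: p odd, σ unramified
outside p, residual type (a,b), a+b even, (b−a) ≡ (p−1)/2 (mod p−1) (typed ¬ (p−1) ∣ (b−a) ∧ (p−1) ∣
2(b−a)), p ∣ B_((p−1)/2) carried as hypothesis (⟺ the Ankeny–Artin–Chowla conjecture fails at p ≡ 1
(mod 4): uh/t ≡ B_((p−1)/2) mod p for ε = (t+u√p)/2; none < 2·10^11 by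
VanderpoortenTerieleWilliams2000 and successors), σ irreducible ⟹ σ is diagonal on Γ_ℚ(√p) = {g :
g•r = r}, r² = p, i.e. σ ≅ Ind of a character of ℚ(√p): a twist of one of the finitely many EVEN
dihedral Artin representations of p-power conductor, which exist exactly at such p (class field
theory: τ = −1 part of the p-ray class group of ℚ(√p)) and are the genuine exceptions to plain
vacuity (anti-invariant p-adic characters of G_(ℚ(√p),{p}) have finite order: the ℤ_p-rank 1 is
cyclotomic). [deps: MirrorCriterion] [difficulty: open-problem] (why it might fail: The even
deformation ring of the residual Ind-type extension may carry non-dihedral irreducible points with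
open image; only the dimension-0 heuristic supports rigidity, and no AAC counterexample prime (<
2·10^11 checked) exists to test it numerically.) [AnkenyArtinChowla1952,
VanderpoortenTerieleWilliams2000, HartHarveyOng2017, Ramakrishna1998, BellaicheChenevier2009,
Washington1997]
#9 KummerHerbrandSplitting (support) — KUMMER–HERBRAND SPLITTING (KNOWN theorem, the classical input
isolated so that MirrorCriterion is the new step; heavy in Lean because Herbrand needs Stickelberger
— wanted as a Literature named fact, see § Definition requests): p odd, k a field of characteristic
p with the discrete topology, ι : ℤ/p → k, ρ̄ : Γ_ℚ → GL₂(k) continuous, unramified outside p, upper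
triangular in the given frame with diagonal (ω^a, ω^b) (ω = ι ∘ toZMod ∘ χ_p; sub = ω^a on e₀,
quotient = ω^b), a+b even, j := (a−b) mod (p−1) ≠ 0, p ∤ B_j ⟹ ρ̄ is split (diagonal in some frame).
Paper proof: the class lies in H¹(G_(ℚ,{p,∞}), 𝔽_p(ω^j)) ⊗ k; inflation–restriction to ℚ(μ_p) and
Kummer theory give h¹(ω^j) = dim (O[1/p]^×/p)(ω^(1−j)) + d_p Cl(ω^(1−j)); for j even ≢ 0 the S-units
carry no ω^(1−j) (μ_p: ω; 1−ζ: trivial; real units: even characters), so h¹(ω^j) = d_p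
Cl(ℚ(μ_p))(ω^(1−j)), the ODD reflected eigenspace, and Herbrand (i = 1−j odd ⟹ p ∣ B_(p−i) = B_j)
finishes. Checks: p = 3 vacuous; p = 5, j = 2: B_2 = 1/6, h = 1, split ✓; (37, 32): H¹(ω^32) ≠ 0 (37
∣ B_32) while H¹(ω^4) = 0 — the asymmetry that kills even σ of type (0,32). False for odd j (h¹ − h²
= 1: Eisenstein congruences), hence the hypothesis Even (a+b). [difficulty: XL] [Lang1990,
Washington1997, Ribet1976]
#9 ScalarResidueReducible (support) — SCALAR RESIDUE IS ABELIAN (the card's flagged case M5, settled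
for conductor p^∞): p odd, σ : Γ_ℚ → GL₂(ℚ̄_p) unramified outside p with residual type (a,b), a ≡ b
(mod p−1) ⟹ σ is reducible. Proof: twist by the Teichmüller lift of ω^(−a) (finite order, unramified
outside p); the image then reduces into a unipotent group, hence is pro-p, so the twist factors
through the maximal pro-p quotient of G_(ℚ,{p,∞}), which is pro-cyclic (≅ ℤ_p: Hom(G_(ℚ,{p,∞}), ℤ/p)
is 1-dimensional by Kronecker–Weber, p odd); an abelian image has a common eigenvector over ℚ̄_p.
Lean debts: Baire descent to GL₂(E), twisting a FramedGaloisRep by a character, the KroneckerWeber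
named facts of the tree. p = 2 rightly excluded (Hom(G_(ℚ,{2,∞}), ℤ/2) has dimension 2; card
one-relator-worlds lives there). [difficulty: M] [Washington1997, Berger2018]
#9 VoidBelow1024 (support) — THE STRONG VACUITY THEOREM BELOW 2^10 (hypothesis = verbatim
KummerHerbrandSplitting): for every odd prime p < 1024, every continuous σ : Γ_ℚ → GL₂(ℚ̄_p)
unramified outside p with reducible residue (type (a,b)) and even (a+b even) is REDUCIBLE — 'no even
irreducible 2-dimensional p-adic Galois representation of conductor p^∞ with reducible reduction
exists, geometric or not', new at each of the 81 irregular pairs with p < 1024. Proof =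
MirrorCriterion (fed the hypothesis) + ScalarResidueReducible + the finite check that no prime p <
1024 has a mirror pair {k, p−1−k} of irregular indices (self-pairs included), kernel-decidable
through Σ_(a<p) a^k ≡ p·B_k (mod p²) or one Bernoulli-mod-p non-divisibility certificate per
unordered pair; verified independently twice (gen-0 planner scan p < 8192; refuter scan p < 1100: 64
irregular primes / 81 pairs below 1024, no mirror pair, no self-index). Bound 1024 is for kernel
feasibility, not truth; restate higher once a verified checker lands. [difficulty: M]
[HartHarveyOng2017, BuhlerHarvey2011, Washington1997]
#9 SectorComplement (support) — OUT-OF-SCOPE REMAINDER = the rest of the summit: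
EvenReducibleResidueClassification → Langlands. NOT attacked by this route and not expected to close
before the summit itself; filed only so that the deciding theorem `closes : KummerHerbrandSplitting
→ MirrorCriterion → NonSelfMirrorReducible → SelfMirrorDihedral → ScalarResidueReducible →
SectorComplement → _root_.Langlands` honestly concludes the summit constant (D-0027 §2.1; same
convention as E8QuinticResidue.SectorComplement, QuadraticWindow.BeyondTheWindow,
EisensteinMonodromy.MonodromyToLanglands, CapacityClassicality.SectorToLanglands — the summit shape
∀ F ∃ 𝓡 ∀ n, (A) ∧ (B) cannot follow from one sector). It contains everything this thesis does not
claim: direction (A); every (F, n) ≠ (ℚ, 2); for (ℚ, 2) every ρ outside the sector (odd ρ,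
irreducible residue, ramification away from ℓ = p); local–global compatibility at every finite place
and the reciprocity data 𝓡 even inside the sector (where, given X, (B) is vacuous for distinct
Hodge–Tate weights and is automorphic induction from ℚ(√p) for the dihedral Artin twists). Trivially
implied by Langlands. Refuters/graders: judge the route on EvenReducibleResidueClassification and
the three cruxes, not on this item; never staffed from this route. [difficulty: open-problem]
[BuzzardGeeLMS2014, FontaineMazurGeometric1995]
#9 CruxesToClassification (support) — GLUE TO THE TARGET (rev 3; badge repair of
`route.target-unreachable`): KummerHerbrandSplitting → MirrorCriterion → NonSelfMirrorReducible →
SelfMirrorDihedral → ScalarResidueReducible → EvenReducibleResidueClassification — the case analysis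
by which the two cruxes and the supports yield X, filed as an item so that an item of the route
CONCLUDES the target (chain: cruxes → X → Statement via SectorComplement; `closes` keeps deriving X
inline and is unchanged). Proof, provable now (planner folder Sketch.lean, lean check rc 0, 0
sorries; verbatim the body of `closes`): σ even of type (a,b), irreducible — if (p−1) ∣ (b−a),
ScalarResidueReducible contradicts; else MirrorCriterion (fed KummerHerbrandSplitting) gives p ∣ B_m
∧ p ∣ B_(p−1−m); if ¬ (p−1) ∣ 2(b−a), NonSelfMirrorReducible contradicts; else Int.emod arithmetic
gives 2m = p−1, parity of a+b gives p ≡ 1 (mod 4), the Bernoulli index rewrites to (p−1)/2 and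
SelfMirrorDihedral supplies the dihedral clause. [deps: KummerHerbrandSplitting, MirrorCriterion,
NonSelfMirrorReducible, SelfMirrorDihedral, ScalarResidueReducible] [difficulty: provable-now]
[Ribet1976, Berger2018, AnkenyArtinChowla1952]

TWO-LAYER PLAN. Foreseen glued splits (nothing filed now; k ≤ 3, depth 1): MirrorCriterion ⇐
ResidualTypeFromTraces (ℚ̄_p → finite E, lattice, σ̄^ss = ω^a ⊕ ω^b
from the trace congruence) → RibetTwoEndpoints (both non-split endpoint reductions, unramified
outside p) → MirrorCriterion;
NonSelfMirrorReducible ⇐ (at the FIRST genuine mirror pair (p; m, p−1−m) found by the 2^31 scan)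
CupProductPresentation (R^even of the non-split
residual extension presented by McCallum–Sharifi cup products, MccallumSharifi2003) →
NoIrreduciblePoint → NonSelfMirrorReducible restricted to
that p, plus the generic remainder; KummerHerbrandSplitting ⇐ KummerRadicalCount (h¹(ω^j) = d_p
Cl(ω^(1−j)) for even j) → Herbrand (Literature
fact) → KummerHerbrandSplitting.

KILL CRITERIA. (i) An irreducible even σ : G_(ℚ,{p}) → GL₂(ℚ̄_p) with reducible non-scalar residue
at a prime WITHOUT a mirror pair refutes MirrorCriterion and
the card: close `refuted:MirrorCriterion`. (ii) An irreducible even σ with infinite projective image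
at a genuine mirror pair (resp. an AAC prime)
refutes NonSelfMirrorReducible (resp. SelfMirrorDihedral) and the target as stated: the route then
RETREATS to the Fontaine–Mazur form (add
'de Rham at p with distinct Hodge–Tate weights' to the hypotheses of the refuted crux and of X; the
glue is unchanged) — a misstated-class repair,
not a close. (iii) A mirror pair below 1024 refutes VoidBelow1024 only (not in the deciding theorem;
restate the bound). (iv) Novelty kill: a
printed two-lattice/odd-eigenspace criterion regrades the route 'known' but leaves
NonSelfMirrorReducible, SelfMirrorDihedral and VoidBelow1024
standing. (v) Proved elsewhere: a general even Fontaine–Mazur theorem for residually reducible ρ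
(none in sight) would moot the FM consequence,
not the classification.

NOT DECOMPOSED YET. The cup-product presentation of the even deformation ring at a mirror pair (only
worth doing at an actual pair — the 2^31 table scan comes
first); auxiliary tame level T (card M1 variant: σ unramified outside {p} ∪ T); the rank-n
'irregular cycle' criterion via Bellaïche–Chenevier
Ext-quivers (card M4); the conductor-one closure list of (B) for GL₂/ℚ as named facts (card M6); p =
2 (card one-relator-worlds); the
Fontaine–Mazur-form fallback statements of Kill criterion (ii).

CHEAPEST FALSIFIER. The MIRROR SCAN (kit, minutes once the data is in hand): take the complete table
of irregular pairs (p, k), p < 2^31 (HartHarveyOng2017 §1,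
hosted by D. Harvey; BuhlerHarvey2011 to 163·10^6) and list every prime with two irregular indices
k, k' satisfying k + k' = p − 1, including
k = k' = (p−1)/2. EMPTY ⟹ the strong vacuity statement 'no even irreducible σ of conductor p^∞ with
reducible residue' holds for every p < 2^31
modulo the two proved-on-paper items, and the cruxes NonSelfMirrorReducible / SelfMirrorDihedral are
numerically untestable (not refuted);
A HIT (p; m, p−1−m) ⟹ the first concrete test of NonSelfMirrorReducible: compute R^even there
(McCallum–Sharifi cup products) — if it has an
irreducible ℚ̄_p-point the crux dies (Kill (ii)). Already run: no mirror pair and no self-pair for p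
< 8192 (gen-0 planner, power-sum
congruence Σ_(a<p) a^k ≡ p·B_k mod p², evidence on stmt-Langlands-3253/3230) and independently p <
1100 (refuter). Second cheapest: the
novelty lookup of Kill (iv) (7 audit passes so far found nothing).

NUMBERS. Irregular pairs below 1024: 81 at 64 irregular primes (37:32, 59:44, 67:58, 101:68, 103:24,
131:22, 149:130, 157:62,110, …); mirror pairs
{k, p−1−k} below 8192: 0; self-pairs k = (p−1)/2 (AAC failures) below 2·10^11: 0
(VanderpoortenTerieleWilliams2000 and successors); index of
irregularity ≤ 9 for p < 2^31 (HartHarveyOng2017); expected number of genuine mirror pairs below x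
under the Poisson(1/2) model ≈ ¼ log log x + O(1),
i.e. ≈ 0.3–0.8 below 2^31 and infinitely many in all; Calegari2011: even FM for p > 7 with
absolutely irreducible non-exceptional residue;
Berger2018 Prop. 2: one lattice + split at p + Vandiver ⟹ odd. Items at open: 9 (3 cruxes); after
the 2026-08-15 retriage and the rev-3 glue item: 11 (target, assembly, 2 cruxes, 7 support incl. the
informal MirrorScan).

DEFINITION REQUESTS. No new notion is needed for the typed items (FramedGaloisRep,
FramedRep.trace/IsIrreducible, IsUnramifiedAt, GaloisRep.cyclotomicCharacter,
PadicAlgCl, bernoulli all exist and the cone is the summit's own). Literature facts WANTED (they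
unblock the support items, not the cruxes):
Herbrand's theorem (Washington1997 Thm 6.17: A(ω^i) ≠ 0, i odd ⟹ p ∣ B_(p−i)) with the
Kummer-radical count for ℚ(μ_p) (Washington1997
Thm 10.9 / Lang1990 Ch. 6 §1) — for KummerHerbrandSplitting; the ℤ/p-extensions of ℚ unramified
outside p (Kronecker–Weber, tree
KroneckerWeber*) — for ScalarResidueReducible; Ribet's lemma with BOTH endpoint lattices (Ribet1976
Prop. 2.1, BellaicheChenevier2009 §1.5)
— for MirrorCriterion. An informal support item MirrorScan (the 2^31 table scan, kit) is filed right
after open.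

Novelty: Searches (2026-08-15, this seat, on top of the card's 7 audit passes and the gen-0 route's
searches): `lit search --source zbmath "even Galois
representations Fontaine-Mazur residually reducible"` (1: SkinnerWiles1999); `--source zbmath
"Galois representations ramified at one prime"`
(25 rows: Ray2021 = arXiv:2012.08122 READ pp. 2–6 — Lemma 3.2/Thm 3.3 use the same Ш¹/Ш²–class-group
bookkeeping FORWARD with the parity
'k_i odd for i even' that makes every root character odd; KhareLarsenRamakrishna 2005; Dembélé 2009;
nothing even/reducible); `--source arxiv
"even Galois representations residually reducible"` (3: Berger arXiv:1611.09315 = Berger2018, two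
unrelated); `lit galaxy search "even Galois
representations" --star all` (2 book rows: Bergeron, ANTS VIII — no criterion) and `--mode
intelligent --star pdf` on the even/reducible/
Bernoulli question (15 survey-level rows: Weinstein BAMS 2015, Frenkel, Mazur — none on point); `lit
frontier Langlands --since 2022` (30
descendants, none in this sector); local/openalex/s2 cascades unavailable this session (rc 75 / 429)
— the gen-0 seat's crossref/S2/hybrid
queries and the audit's reading of Calegari's even-representation notes stand. Ray2021 added to
references.bib.
Nearest prior art found: Berger2018 Prop. 2 / Rem. 3 (arXiv:1611.09315 p. 3: ONE Ribet lattice +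
split at p + VANDIVER ⟹ odd; 'crystallinity
alone is not enough'); Greenberg2016 and Ray2021 (same cohomology, existence direction, odd root
characters, regular or index-  [refs: 2012.08122, 1611.09315, SkinnerWiles1999, Ray2021, Berger2018, Greenberg2016, Calegari2011, Ribet1976]

Barriers (technique_class: cyclotomic-reflection ribet-lattice bernoulli-census): - technique_class: cyclotomic-reflection ribet-lattice bernoulli-census
- Literature.Barriers.Langlands.ResiduallyReducibleBarrier: the route lives INSIDE this barrier's
regime (reducible residue: Mazur's k ≅ End condition and H⁰(ad⁰) = 0 fail, no Taylor–Wiles primes)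
and uses none of the blocked hypotheses, because it proves NON-EXISTENCE (reducible-or-dihedral)
rather than automorphy: no R = T, no patching, no residual automorphy; the barrier's printed content
(SkinnerWiles1999: reducible deformation rings not equidimensional, ordinarity essential) is why a
Galois-only criterion is the right tool in the even sector, where there is nothing to lift to.
- Literature.Barriers.Langlands.TaylorWilesNumericalCoincidence: consistent with it and used only as
a heuristic — for even 2-dimensional ρ̄ over ℚ complex conjugation acts trivially on ad ρ̄, so
h¹(ad⁰) − h²(ad⁰) = 0 and the even deformation ring has expected relative dimension 0; the route
never patches, it turns 'dimension 0' into Bernoulli arithmetic (MirrorCriterion) and isolates the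
rigidity statements (NonSelfMirrorReducible, SelfMirrorDihedral) whose failure mode is exactly an
isolated point that dimension counting cannot exclude.
- Literature.Barriers.Langlands.NonRegularWeightBarrier: not an obstruction here; it explains why
the self-mirror dihedral Artin σ (equal Hodge–Tate weights, Maass-type) are compatible with
Fontaine–Mazur and must appear in the classification rather than be excluded.
- Literature.Barriers.Lang

History (route lifecycle, newest last):
- 2026-08-16T16:43:12Z · AUTO-CRUX (backfill): SectorComplement — hypotheses of the deciding theorem that nothing in the route derives are cruxes (operator:999:1813213)
- 2026-08-17T07:15:10Z · rev 5: dropped PairLBoundaryJS, PairLPoleJS — (planner-cstrat-stmt-Langlands-12840-r1-0)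
- 2026-08-25T07:22:03Z · DORMANT — reconciler: no traction for 7.5 d (last activity item-evidence-added at 2026-08-17T19:05:05Z); parked, not closed — `ledger route dormant route-Langlands-Mirror (operator:999:581096)
- 2026-08-29T00:29:04Z · REACTIVATED — reconciler: reactivated — activity statement-checked at 2026-08-28T21:32:13Z after parking at 2026-08-25T07:22:03Z (operator:999:32771)

sub-problem: Langlands · status: open · opened planner-plancard-Langlands-Langlands-conducto-96b98e8b-g2-0 2026-08-15T18:59:10Z · rev 7 · ledger route-Langlands-MirrorPairReflection
GENERATED by the gate from the ledger (D-0016/17). Provers cite these decls: `theorem foo : Summit.Langlands.Langlands.Theses.MirrorPairReflection.<Decl> := …` in Summits/Langlands/Langlands/Theorems/<Name>.lean.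
-/

namespace Summit.Langlands.Langlands.Theses.MirrorPairReflection

open scoped BigOperators Topology Manifold Classical MeasureTheory ProbabilityTheory Matrix InnerProductSpace ComplexConjugate ContinuousMap
open Filter Set Function TopologicalSpace MeasureTheory

attribute [summit_statement] _root_.Langlands

/-- item stmt-Langlands-12833 · target · rank 0 · open · by planner
why it might fail: Fails exactly where NonSelfMirrorReducible or SelfMirrorDihedral fails: an irreducible even σ of conductor p^∞, reducible non-scalar residue, non-dihedral image at a genuine mirror pair (none < 8192) or an AAC prime (none < 2·10^11); elsewhere MirrorCriterion + ScalarResidueReducible settle it.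
sources: Berger2018, Calegari2011, Ribet1976, AnkenyArtinChowla1952, Greenberg2016, Ray2021
[target] X as in § Thesis — classification of the even, residually reducible, conductor-p^∞ sector
of (B) for GL₂/ℚ, p odd: reducible, or (p ≡ 1 mod 4, self-mirror index, p ∣ B_((p−1)/2), and σ
diagonal on Γ_ℚ(√p)). Typing: residual type by the trace congruence (n = 2 < p, so traces give
σ̄^ss), evenness as Even (a+b), dihedral as simultaneous diagonalisability on the stabiliser of a
square root r of p in ℚ̄. -/
@[route_item "route-Langlands-MirrorPairReflection"]
def EvenReducibleResidueClassification : Prop :=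
  ∀ (p : ℕ) [Fact p.Prime], p ≠ 2 → ∀ (σ : Literature.NumberTheory.GaloisRepresentations.FramedGaloisRep ℚ (PadicAlgCl p) 2) (a b : ℕ), (∀ v : IsDedekindDomain.HeightOneSpectrum (NumberField.RingOfIntegers ℚ), ((p : ℕ) : NumberField.RingOfIntegers ℚ) ∉ v.asIdeal → σ.IsUnramifiedAt v) → Even (a + b) → (∀ g : Field.absoluteGaloisGroup ℚ, ‖Literature.NumberTheory.GaloisRepresentations.FramedRep.trace σ g - ((algebraMap ℚ_[p] (PadicAlgCl p) (((Literature.NumberTheory.GaloisRepresentations.GaloisRep.cyclotomicCharacter ℚ p g : ℤ_[p]ˣ) : ℤ_[p]) : ℚ_[p])) ^ a + (algebraMap ℚ_[p] (PadicAlgCl p) (((Literature.NumberTheory.GaloisRepresentations.GaloisRep.cyclotomicCharacter ℚ p g : ℤ_[p]ˣ) : ℤ_[p]) : ℚ_[p])) ^ b)‖ < 1) → Literature.NumberTheory.GaloisRepresentations.FramedRep.IsIrreducible σ → p % 4 = 1 ∧ 2 * (((b : ℤ) - a) % ((p : ℤ) - 1)).toNat = p - 1 ∧ ((p : ℤ)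 ∣ (bernoulli ((p - 1) / 2)).num) ∧ (∃ (P : Matrix.GeneralLinearGroup (Fin 2) (PadicAlgCl p)) (r : AlgebraicClosure ℚ), r ^ 2 = (p : AlgebraicClosure ℚ) ∧ ∀ g : Field.absoluteGaloisGroup ℚ, g • r = r → ((P * σ g * P⁻¹ : Matrix.GeneralLinearGroup (Fin 2) (PadicAlgCl p)) : Matrix (Fin 2) (Fin 2) (PadicAlgCl p)) 0 1 = 0 ∧ ((P * σ g * P⁻¹ : Matrix.GeneralLinearGroup (Fin 2) (PadicAlgCl p)) : Matrix (Fin 2) (Fin 2) (PadicAlgCl p)) 1 0 = 0)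

/-- item stmt-Langlands-12834 · crux · rank 2 · open · by planner
why it might fail: At a genuine mirror pair both H¹(G_{ℚ,{p,∞}}, ω^{±m}) ≠ 0, so the reflection obstruction is gone and nothing known forbids an isolated even open-image σ : G_{ℚ,{p}} → GL₂(ℤ_p) (non-geometric, outside Fontaine–Mazur/Calegari2011): expected dimension 0 kills families, not points (cf. Ramakrishna1998).
sources: Greenberg2016, Ray2021, arXiv:2012.08122, Ramakrishna1998, MccallumSharifi2003, Calegari2011
[crux] RIGIDITY AT A GENUINE MIRROR PAIR (card M2 as a statement; the open residue of the sector): p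
odd, σ : Γ_ℚ → GL₂(ℚ̄_p) continuous, unramified outside p, residual type (a,b), a+b even, m := (b−a)
mod (p−1) ∉ {0, (p−1)/2} (typed ¬ (p−1) ∣ 2(b−a)), and p ∣ B_m ∧ p ∣ B_(p−1−m) (the only case
MirrorCriterion leaves, so the divisibilities are hypotheses). CLAIM: σ is reducible — no even
2-dimensional p-adic representation of conductor p^∞ with infinite (necessarily non-dihedral) image
has reducible non-scalar residue. For: no ARTIN σ has this type (a finite subgroup of GL₂(ℤ̄_p)
reducing into a Borel with distinct characters is P⋊C; an irreducible plane forces the dihedral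
shape m = (p−1)/2); the even deformation ring of the non-split residual extension has expected
relative dimension h¹(ad⁰) − h²(ad⁰) = 0 (complex conjugation acts trivially on ad), tangent
directions governed by McCallum–Sharifi cup products of cyclotomic p-units; no instance below 8192
(gen-0 planner power-sum scan, refuter scan < 1100, evidence on the old items
stmt-Langlands-3230/3253), ≈ 0.3–0.8 genuine mirror pairs expected below 2^31 (HartHarveyOng2017
tables). [deps: MirrorCriterion] [difficulty: open-prob -/
@[route_item "route-Langlands-MirrorPairReflection", crux]
def NonSelfMirrorReducible : Prop :=
  ∀ (p : ℕ) [Fact p.Prime], p ≠ 2 → ∀ (σ : Literature.NumberTheory.GaloisRepresentations.FramedGaloisRep ℚ (PadicAlgCl p) 2) (a b : ℕ), (∀ v : IsDedekindDomain.HeightOneSpectrum (NumberField.RingOfIntegers ℚ), ((p : ℕ) : NumberField.RingOfIntegers ℚ) ∉ v.asIdeal → σ.IsUnramifiedAt v) → Even (a + b) → ¬ ((p : ℤ) - 1 ∣ 2 * ((b : ℤ) - a)) → (∀ g : Field.absoluteGaloisGroup ℚ, ‖Literature.NumberTheory.GaloisRepresentations.FramedRep.trace σ g - ((algebraMap ℚ_[p]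 (PadicAlgCl p) (((Literature.NumberTheory.GaloisRepresentations.GaloisRep.cyclotomicCharacter ℚ p g : ℤ_[p]ˣ) : ℤ_[p]) : ℚ_[p])) ^ a + (algebraMap ℚ_[p] (PadicAlgCl p) (((Literature.NumberTheory.GaloisRepresentations.GaloisRep.cyclotomicCharacter ℚ p g : ℤ_[p]ˣ) : ℤ_[p]) : ℚ_[p])) ^ b)‖ < 1) → ((p : ℤ) ∣ (bernoulli ((((b : ℤ) - a) % ((p : ℤ) - 1)).toNat)).num) → ((p : ℤ) ∣ (bernoulli (p - 1 - (((b : ℤ) - a) % ((p : ℤ) - 1)).toNat)).num) → ¬ Literature.NumberTheory.GaloisRepresentations.FramedRep.IsIrreducible σ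

/-- item stmt-Langlands-12836 · crux · rank 4 · open · by planner
why it might fail: Rigidity bet: at an AAC-failure prime (p ≡ 1 mod 4, p ∣ B_{(p−1)/2}; none < 2·10^11) the even deformation ring of the non-split Ind-type residue has expected dimension 0 yet may carry an isolated irreducible point NOT induced from ℚ(√p); only 'anti-invariant ℤ_p-rank of G_{ℚ(√p),{p}} = 0' backs it
sources: AnkenyArtinChowla1952, VanderpoortenTerieleWilliams2000, Ramakrishna1998, BellaicheChenevier2009, Washington1997, HartHarveyOng2017
[crux] THE SELF-MIRROR INDEX m = (p−1)/2 IS DIHEDRAL: p odd, σ unramified outside p, residual type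
(a,b), a+b even, (b−a) ≡ (p−1)/2 (mod p−1) (typed ¬ (p−1) ∣ (b−a) ∧ (p−1) ∣ 2(b−a)), p ∣ B_((p−1)/2)
carried as hypothesis (⟺ the Ankeny–Artin–Chowla conjecture fails at p ≡ 1 (mod 4): uh/t ≡
B_((p−1)/2) mod p for ε = (t+u√p)/2; none < 2·10^11 by VanderpoortenTerieleWilliams2000 and
successors), σ irreducible ⟹ σ is diagonal on Γ_ℚ(√p) = {g : g•r = r}, r² = p, i.e. σ ≅ Ind of a
character of ℚ(√p): a twist of one of the finitely many EVEN dihedral Artin representations of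
p-power conductor, which exist exactly at such p (class field theory: τ = −1 part of the p-ray class
group of ℚ(√p)) and are the genuine exceptions to plain vacuity (anti-invariant p-adic characters of
G_(ℚ(√p),{p}) have finite order: the ℤ_p-rank 1 is cyclotomic). [deps: MirrorCriterion] [difficulty:
open-problem] -/
@[route_item "route-Langlands-MirrorPairReflection", crux]
def SelfMirrorDihedral : Prop :=
  ∀ (p : ℕ) [Fact p.Prime], p ≠ 2 → ∀ (σ : Literature.NumberTheory.GaloisRepresentations.FramedGaloisRep ℚ (PadicAlgCl p) 2) (a b : ℕ), (∀ v : IsDedekindDomain.HeightOneSpectrum (NumberField.RingOfIntegers ℚ), ((p : ℕ) : NumberField.RingOfIntegers ℚ) ∉ v.asIdeal → σ.IsUnramifiedAt v) → Even (a + b) → ¬ ((p : ℤ) - 1 ∣ (b : ℤ) - a) → ((p : ℤ) - 1 ∣ 2 * ((b : ℤ) - a)) → (∀ g : Field.absoluteGaloisGroup ℚ, ‖Literature.NumberTheory.GaloisRepresentations.FramedRep.trace σ g - ((algebraMap ℚ_[p] (PadicAlgCl p) (((Literature.NumberTheory.GaloisRepresentations.GaloisRep.cyclotomicCharacter ℚ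 p g : ℤ_[p]ˣ) : ℤ_[p]) : ℚ_[p])) ^ a + (algebraMap ℚ_[p] (PadicAlgCl p) (((Literature.NumberTheory.GaloisRepresentations.GaloisRep.cyclotomicCharacter ℚ p g : ℤ_[p]ˣ) : ℤ_[p]) : ℚ_[p])) ^ b)‖ < 1) → ((p : ℤ) ∣ (bernoulli ((p - 1) / 2)).num) → Literature.NumberTheory.GaloisRepresentations.FramedRep.IsIrreducible σ → (∃ (P : Matrix.GeneralLinearGroup (Fin 2) (PadicAlgCl p)) (r : AlgebraicClosure ℚ), r ^ 2 = (p : AlgebraicClosure ℚ) ∧ ∀ g : Field.absoluteGaloisGroup ℚ, g • r = r → ((P * σ g * P⁻¹ : Matrix.GeneralLinearGroup (Fin 2) (PadicAlgCl p)) : Matrix (Fin 2) (Fin 2) (PadicAlgCl p)) 0 1 = 0 ∧ ((P * σ g * P⁻¹ : Matrix.GeneralLinearGroup (Fin 2) (PadicAlgCl p)) : Matrix (Fin 2) (Fin 2) (PadicAlgCl p)) 1 0 = 0)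

/-- item stmt-Langlands-19093 · crux · rank 7 · open · by planner
why it might fail: Formalization debt, not mathematics (JS II Prop. 3.6 is a theorem): false AS TYPED only by a normalisation slip in the inlined text (q_w^(1−s₀) vs q_w^(s₀−1), unitary normalisation, α vs β⁻¹); ranks ≤ 2 of this exact text are proved in tree (…_pole_repData_rank_of_le_two).
sources: JacquetShalikaAJM1981II, ArthurClozelAMS120, JacquetShalikaAJM1981, ShahidiAJM1981, HumphriesJo2024, CogdellAnalyticTheory2004
[crux] ARTHUR–CLOZEL (2.3) FOR BOREL–JACQUET DATA — PROMOTED LITERATURE INPUT of the junction's line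
(route-choice 2026-08-17, unit rchoice-Summits-Langlands-Langlands-Cr-16a26670: the birth skeleton
Cruxes/SectorComplement/Lines/birth.lean of SectorComplement (stmt-Langlands-14623) consumed the
named fact Literature.NumberTheory.Automorphic.JacquetShalika1981_partialPairL_pole_repData as its
stub stub_pairLPoleJS; that fact is judged XL-apex — too large for one prover seat, and non-crux
Literature facts are not split — so it is promoted to an explicit crux of this route and the line is
rewired to this decl BY NAME). STATEMENT (Jacquet–Shalika II Prop. 3.6 = Arthur–Clozel Ch. 3 §2
(2.3), p. 171, in the Borel–Jacquet model): for cuspidal π, π′ on GL_n(𝔸_F) (n ≥ 1, data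
CuspidalAutomorphicRepData, arbitrary central characters) there is a finite S₀ such that for every
finite S ⊇ S₀, all Satake families α, β of π, π′ off S in unitary normalisation (‖∏α_w‖ = ‖∏β_w‖ =
1) and every s₀ on Re s = 1 IN X (q_w^(1−s₀)·α_w = β_w⁻¹ as multisets for almost all w: the
Hecke-matrix form of π ⊗ |·|^(s₀−1) ≅ σ̃), the limit of (s − s₀)·L^S(s, α × β) as s → s₀ with Re s >
1 exists and is NON-ZERO, wher -/
@[route_item "route-Langlands-MirrorPairReflection"]
def PairLPoleJS : Prop :=
  ∀ (n : ℕ) (F : Type) [Field F] [NumberField F] (hF : Literature.NumberTheory.Automorphic.isCompact_glFiniteIntegralLevel n F), 0 < n → ∀ (π π' : Literature.NumberTheory.Automorphic.CuspidalAutomorphicRepData n F hF), ∃ S₀ : Set (IsDedekindDomain.HeightOneSpectrum (NumberField.RingOfIntegers F)), S₀.Finite ∧ ∀ {S : Set (IsDedekindDomain.HeightOneSpectrum (NumberField.RingOfIntegers F))}, S.Finite → S₀ ⊆ S → ∀ {α β : IsDedekindDomain.HeightOneSpectrum (NumberField.RingOfIntegers F) → Multiset ℂ}, (∀ w ∉ S,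 π.1.HasSatakeParamAt w (α w)) → (∀ w ∉ S, π'.1.HasSatakeParamAt w (β w)) → (∀ w ∉ S, ‖(α w).prod‖ = 1) → (∀ w ∉ S, ‖(β w).prod‖ = 1) → ∀ {s₀ : ℂ}, s₀.re = 1 → (∀ᶠ w in cofinite, (α w).map ((((w.residueCard : ℂ) ^ (1 - s₀))) * ·) = (β w).map (·⁻¹)) → ∃ c : ℂ, c ≠ 0 ∧ Tendsto (fun s : ℂ => (s - s₀) * ∏' w : {w : IsDedekindDomain.HeightOneSpectrum (NumberField.RingOfIntegers F) // w ∉ S}, ((Literature.NumberTheory.Automorphic.satakePairPolynomial (α w.1) (β w.1)).eval ((w.1.residueCard : ℂ) ^ (-s)))⁻¹) (𝓝[{s : ℂ | 1 < s.re}] s₀) (𝓝 c)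

/-- item stmt-Langlands-13622 · crux · rank 8 · SPLIT (gen 1) into PairLFiniteJSNear, PairLFiniteJSGap, PairLReciprocalSh + glue PairLBoundaryJS_of_near_gap_sh · direct attempts still welcome (low priority) · by planner
why it might fail: Formalization debt, not mathematics (JS II Prop. 3.6 off X + Shahidi non-vanishing): false AS TYPED only by a normalisation slip in the inlined text (q_w^(1−s₀) vs q_w^(s₀−1), unitary normalisation, X-condition n = m ∧ α·q^(1−s₀) = β⁻¹ a.e.).
sources: JacquetShalikaAJM1981II, ArthurClozelAMS120, JacquetShalikaAJM1981, ShahidiAJM1981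
[support] INPUT — Jacquet–Shalika 1981 / Arthur–Clozel Ch. 3 (2.2) for cuspidal Borel–Jacquet data
on GL_n × GL_m: off the X-condition (n = m and, a.e., β_w⁻¹ = q_w^{1−s₀}·α_w as multisets), assuming
unitary central characters a.e. (‖∏ α_w‖ = ‖∏ β_w‖ = 1), the partial Rankin–Selberg product L^S(s, α
× β) = ∏'_{w ∉ S} ∏_{a,b} (1 − a b q_w^{−s})⁻¹ has a finite NON-ZERO limit at Re s₀ = 1 from Re s >
1. SAME TEXT as
`Literature.NumberTheory.Automorphic.JacquetShalika1981_partialPairL_boundary_repData` with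
`partialPairL S α β` unfolded to its defining `tprod` over `satakePairPolynomial`
(RankinSelbergLocal, in the Statement's closure) and `SatakeFamily F` unfolded to `HeightOneSpectrum
(𝓞 F) → Multiset ℂ` — definitionally equal (delta/eta), closes by `exact`/`simpa [partialPairL]` the
day the fact's `_holds` lands (it is reduced in tree to its L² leaves). CONE REPAIR 2026-08-15
(route-repair planner): no import of PairLFunctionPolesRepData (whose closure carried 383 modules /
~45 unproved facts into the cone). Rank 1 (renders before IrreducibleGL3CM). [difficulty: L] -/
@[route_item "route-Langlands-MirrorPairReflection"]
def PairLBoundaryJS : Prop :=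
  ∀ (n m : ℕ) (F : Type) [Field F] [NumberField F] (hF : _) (hF' : _), 0 < n → 0 < m → ∀ (π : Literature.NumberTheory.Automorphic.CuspidalAutomorphicRepData n F hF) (π' : Literature.NumberTheory.Automorphic.CuspidalAutomorphicRepData m F hF'), ∃ S₀ : Set (IsDedekindDomain.HeightOneSpectrum (NumberField.RingOfIntegers F)), S₀.Finite ∧ ∀ {S : Set (IsDedekindDomain.HeightOneSpectrum (NumberField.RingOfIntegers F))}, S.Finite → S₀ ⊆ S → ∀ {α β : IsDedekindDomain.HeightOneSpectrum (NumberField.RingOfIntegers F) → Multiset ℂ}, (∀ w ∉ S, π.1.HasSatakeParamAt w (α w)) → (∀ w ∉ S, π'.1.HasSatakeParamAt w (β w)) → (∀ w ∉ S, ‖(α w).prod‖ = 1) → (∀ w ∉ S, ‖(β w).prod‖ = 1) → ∀ {s₀ : ℂ}, s₀.re = 1 → ¬ (n = m ∧ ∀ᶠ w in cofinite, (α w).map ((((w.residueCard : ℂ) ^ (1 - s₀))) * ·) = (β w).map (·⁻¹)) → ∃ c : ℂ, c ≠ 0 ∧ Tendsto (fun s : ℂ => ∏' w : {w : IsDedekindDomain.HeightOneSpectrum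 (NumberField.RingOfIntegers F) // w ∉ S}, ((Literature.NumberTheory.Automorphic.satakePairPolynomial (α w.1) (β w.1)).eval ((w.1.residueCard : ℂ) ^ (-s)))⁻¹) (𝓝[{s : ℂ | 1 < s.re}] s₀) (𝓝 c)

-- parent: PairLBoundaryJS · child (gen 1)
/--     item stmt-Langlands-18100 · crux · rank 801 · open
    parent: PairLBoundaryJS · by operator
    why it might fail: Only as typed: continuity from the right at s0 also needs integrability on Re s ∈ (1, 1+ε] (moderate-growth bound for Gårding Whittaker functions, unproved in tree); a normalisation slip in the inlined telescope (q_w^(1-s0) vs q_w^(s0-1)) would surface at (1,1), which is proved.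
    sources: JacquetShalikaAJM1981II, JacquetShalikaAJM1981, CogdellAnalyticTheory2004
[crux] Jacquet–Shalika half of Arthur–Clozel (2.2) at NEAR ranks |n-m| <= 1 (equal rank off X, and
the corner n = m±1), for cuspidal Borel–Jacquet data: off a finite S0, for every finite S ⊇ S0,
unitary Satake families and every s0 on Re s = 1 (off X when n = m), lim_{s→s0, Re s>1} L^S(s, α×β)
EXISTS. Engine: the landed global roads (mirabolic Eisenstein integral at equal rank, JPSS corner
road) taken AT the boundary; archimedean input SOFT and classification-free: absolute convergence at
Re s = 1 by Cauchy–Schwarz from the Kirillov L²-bound JacquetShalika1981_archKirillovNorm_le r K (JS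
I Prop. (3.16)/(3.17); r = 1 i.e. GL2(K_∞) PROVED in tree, ArchKirillovBoundGL2) + one non-vanishing
K_∞-finite datum (Gårding density). -/
@[route_item "route-Langlands-MirrorPairReflection"]
def PairLFiniteJSNear : Prop :=
  ∀ (n m : ℕ) (F : Type) [Field F] [NumberField F] (hF : Literature.NumberTheory.Automorphic.isCompact_glFiniteIntegralLevel n F) (hF' : Literature.NumberTheory.Automorphic.isCompact_glFiniteIntegralLevel m F), 0 < n → 0 < m → (n = m ∨ n = m + 1 ∨ m = n + 1) → ∀ (π : Literature.NumberTheory.Automorphic.CuspidalAutomorphicRepData n F hF) (π' : Literature.NumberTheory.Automorphic.CuspidalAutomorphicRepData m F hF'), ∃ S₀ : Set (IsDedekindDomain.HeightOneSpectrum (NumberField.RingOfIntegers F)), S₀.Finite ∧ ∀ {S : Set (IsDedekindDomain.HeightOneSpectrum (NumberField.RingOfIntegers F))}, S.Finite → S₀ ⊆ S → ∀ {α β : IsDedekindDomain.HeightOneSpectrum (NumberField.RingOfIntegers F) → Multiset ℂ}, (∀ w ∉ S, π.1.HasSatakeParamAt w (α w)) → (∀ w ∉ S, π'.1.HasSatakeParamAt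 w (β w)) → (∀ w ∉ S, ‖(α w).prod‖ = 1) → (∀ w ∉ S, ‖(β w).prod‖ = 1) → ∀ {s₀ : ℂ}, s₀.re = 1 → ¬ (n = m ∧ ∀ᶠ w in cofinite, (α w).map ((((w.residueCard : ℂ) ^ (1 - s₀))) * ·) = (β w).map (·⁻¹)) → ∃ c : ℂ, Tendsto (fun s : ℂ => ∏' w : {w : IsDedekindDomain.HeightOneSpectrum (NumberField.RingOfIntegers F) // w ∉ S}, ((Literature.NumberTheory.Automorphic.satakePairPolynomial (α w.1) (β w.1)).eval ((w.1.residueCard : ℂ) ^ (-s)))⁻¹) (𝓝[{s : ℂ | 1 < s.re}] s₀) (𝓝 c)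

-- parent: PairLBoundaryJS · child (gen 1)
/--     item stmt-Langlands-18104 · crux · rank 802 · open
    parent: PairLBoundaryJS · by operator
    why it might fail: Not mathematically (Cogdell Thm 4.2: L(s, π×π') is entire for m < n); as an item it is blocked on archimedean exponent/asymptotic input at |n-m| >= 2 — the K_∞-finite corner integral ∫ W(diag(h,1_{n-m})) W'(h) |det h|^(s-(n-m)/2) does NOT converge at Re s = 1 from L²-bounds alone when n-m >= 2.
    sources: CogdellAnalyticTheory2004, JacquetArchimedeanRS2009, JPSS1983
[crux] Jacquet–Shalika half of Arthur–Clozel (2.2) at GAP ranks |n-m| >= 2 (no X-condition arises),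
same telescope: lim_{s→s0, Re s>1} L^S(s, α×β) exists at every s0 on Re s = 1. Follows TODAY from
the landed PairLBoundaryJSOfArchFacts.partialPairL_entire_of_lt granted the archimedean gap fact
JacquetShalika1990_archRankinSelbergGap_entireRatio (Jacquet 2009 Thm 2.1/2.6, Prop 12.5); fact-free
alternatives: decay of K_∞-finite Whittaker functions at the corner cusp (exponent bounds |Re μ| <
1/2 for unitary generic, JS I Cor. (2.5)) giving absolute convergence at Re s = 1, or smooth
compactly supported Kirillov data (Kirillov surjectivity, Jacquet 2010 / Kemarsky 2015) with a
smooth-vector global road. -/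
@[route_item "route-Langlands-MirrorPairReflection"]
def PairLFiniteJSGap : Prop :=
  ∀ (n m : ℕ) (F : Type) [Field F] [NumberField F] (hF : Literature.NumberTheory.Automorphic.isCompact_glFiniteIntegralLevel n F) (hF' : Literature.NumberTheory.Automorphic.isCompact_glFiniteIntegralLevel m F), 0 < n → 0 < m → (m + 2 ≤ n ∨ n + 2 ≤ m) → ∀ (π : Literature.NumberTheory.Automorphic.CuspidalAutomorphicRepData n F hF) (π' : Literature.NumberTheory.Automorphic.CuspidalAutomorphicRepData m F hF'), ∃ S₀ : Set (IsDedekindDomain.HeightOneSpectrum (NumberField.RingOfIntegers F)), S₀.Finite ∧ ∀ {S : Set (IsDedekindDomain.HeightOneSpectrum (NumberField.RingOfIntegers F))}, S.Finite → S₀ ⊆ S → ∀ {α β : IsDedekindDomain.HeightOneSpectrum (NumberField.RingOfIntegers F) → Multiset ℂ}, (∀ w ∉ S, π.1.HasSatakeParamAt w (α w)) → (∀ w ∉ S, π'.1.HasSatakeParamAt w (β w)) → (∀ w ∉ S, ‖(α w).prod‖ = 1) → (∀ w ∉ S, ‖(β w).prod‖ = 1) → ∀ {s₀ : ℂ}, s₀.re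 = 1 → ∃ c : ℂ, Tendsto (fun s : ℂ => ∏' w : {w : IsDedekindDomain.HeightOneSpectrum (NumberField.RingOfIntegers F) // w ∉ S}, ((Literature.NumberTheory.Automorphic.satakePairPolynomial (α w.1) (β w.1)).eval ((w.1.residueCard : ℂ) ^ (-s)))⁻¹) (𝓝[{s : ℂ | 1 < s.re}] s₀) (𝓝 c)

-- parent: PairLBoundaryJS · child (gen 1)
/--     item stmt-Langlands-18105 · crux · rank 803 · open
    parent: PairLBoundaryJS · by operator
    why it might fail: XL formalization debt, not mathematics; as typed it also covers the X-points (needs 1/L^S → 0 there: on road I by meromorphy at the point + positivity L^S(σ,π×π̃) ≥ 1, on road II by continuity of E_ψ/c_S) — a consequence of AC (2.2)∧(2.3) in every rank.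
    sources: ShahidiAJM1981, ShahidiBAMS1980, MoeglinWaldspurger1989, ArthurClozelAMS120
[crux] Shahidi half of Arthur–Clozel (2.2) in RECIPROCAL form (C+ = ReciprocalBoundaryValues;
verbatim stub_sh_half of line halves): same telescope, NO X-condition: at every s0 on Re s = 1,
lim_{s→s0, Re s>1} (L^S)^(-1) exists (it is 0 exactly at the poles). Engines: (II) the ψ-Whittaker
coefficient E_ψ(s) = c_S(s)/L^S(1+s, π×π̃') of the cuspidal-data Eisenstein series on GL_{n+m} ⊃
P_{n,m} on its unitary axis (Shahidi BAMS 1980 / AJM 1981 Thm 5.1; needs new objects: Eisenstein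
series, constant term, Jacquet integral), or (I) the lead's Mœglin–Waldspurger/Landau road
(zero-free strip continuation ⇒ reciprocal limits; archimedean input =
HumphriesJo2024_archRankinSelberg_testVector). PROVED at (1,1) (halves.sh_half_one_one). -/
@[route_item "route-Langlands-MirrorPairReflection"]
def PairLReciprocalSh : Prop :=
  ∀ (n m : ℕ) (F : Type) [Field F] [NumberField F] (hF : Literature.NumberTheory.Automorphic.isCompact_glFiniteIntegralLevel n F) (hF' : Literature.NumberTheory.Automorphic.isCompact_glFiniteIntegralLevel m F), 0 < n → 0 < m → ∀ (π : Literature.NumberTheory.Automorphic.CuspidalAutomorphicRepData n F hF) (π' : Literature.NumberTheory.Automorphic.CuspidalAutomorphicRepData m F hF'), ∃ S₀ : Set (IsDedekindDomain.HeightOneSpectrum (NumberField.RingOfIntegers F)), S₀.Finite ∧ ∀ {S : Set (IsDedekindDomain.HeightOneSpectrum (NumberField.RingOfIntegers F))}, S.Finite → S₀ ⊆ S → ∀ {α β : IsDedekindDomain.HeightOneSpectrum (NumberField.RingOfIntegers F) → Multiset ℂ}, (∀ w ∉ S, π.1.HasSatakeParamAt w (α w)) → (∀ w ∉ S, π'.1.HasSatakeParamAt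 w (β w)) → (∀ w ∉ S, ‖(α w).prod‖ = 1) → (∀ w ∉ S, ‖(β w).prod‖ = 1) → ∀ {s₀ : ℂ}, s₀.re = 1 → ∃ ℓ : ℂ, Tendsto (fun s : ℂ => (∏' w : {w : IsDedekindDomain.HeightOneSpectrum (NumberField.RingOfIntegers F) // w ∉ S}, ((Literature.NumberTheory.Automorphic.satakePairPolynomial (α w.1) (β w.1)).eval ((w.1.residueCard : ℂ) ^ (-s)))⁻¹)⁻¹) (𝓝[{s : ℂ | 1 < s.re}] s₀) (𝓝 ℓ)

-- parent: PairLBoundaryJS · glue (gen 1)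
/--     item stmt-Langlands-18106 · support · rank 804 · closed · proved by Summit.Langlands.Langlands.Theorems.MirrorPairReflectionPairLBoundaryJSOfNearGapSh.pairLBoundaryJS_of_near_gap_sh (prover)
    parent: PairLBoundaryJS · GLUE: children ⟹ parent · by operator
PairLFiniteJSNear → PairLFiniteJSGap → PairLReciprocalSh → PairLBoundaryJS: case split on the ranks
(omega), the two boundary limits multiply along the proper filter 𝓝[Re s>1] s₀, and L^S·(L^S)⁻¹ = 1
on Re s>1 by Arthur–Clozel (2.1) in non-vanishing form for Borel–Jacquet data; PROVED sorry-free in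
the strategist's Split3.lean (evidence on stmt-Langlands-13622, lean check rc0, std axioms) — to be
landed verbatim by any prover -/
@[route_item "route-Langlands-MirrorPairReflection"]
def PairLBoundaryJS_of_near_gap_sh : Prop :=
  PairLFiniteJSNear → PairLFiniteJSGap → PairLReciprocalSh → PairLBoundaryJS

-- `PairLBoundaryJS_of_near_gap_sh` holds: proved by `Summit.Langlands.Langlands.Theorems.MirrorPairReflectionPairLBoundaryJSOfNearGapSh.pairLBoundaryJS_of_near_gap_sh` (its module imports this route file, so no `_holds` link can be stated here).

/-- item stmt-Langlands-12840 · crux (kind.auto-crux: conjecture-grade) · rank 9 · open · by planner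
why it might fail: auto-crux — summit-strength (notes:refuter-refute-pool-g44-27): the deciding theorem assumes it and nothing in the route derives it, so it is a bet, not glue
sources: BuzzardGeeLMS2014, FontaineMazurGeometric1995
[support] OUT-OF-SCOPE REMAINDER = the rest of the summit: EvenReducibleResidueClassification →
Langlands. NOT attacked by this route and not expected to close before the summit itself; filed only
so that the deciding theorem `closes : KummerHerbrandSplitting → MirrorCriterion →
NonSelfMirrorReducible → SelfMirrorDihedral → ScalarResidueReducible → SectorComplement →
_root_.Langlands` honestly concludes the summit constant (D-0027 §2.1; same convention as
E8QuinticResidue.SectorComplement, QuadraticWindow.BeyondTheWindow,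
EisensteinMonodromy.MonodromyToLanglands, CapacityClassicality.SectorToLanglands — the summit shape
∀ F ∃ 𝓡 ∀ n, (A) ∧ (B) cannot follow from one sector). It contains everything this thesis does not
claim: direction (A); every (F, n) ≠ (ℚ, 2); for (ℚ, 2) every ρ outside the sector (odd ρ,
irreducible residue, ramification away from ℓ = p); local–global compatibility at every finite place
and the reciprocity data 𝓡 even inside the sector (where, given X, (B) is vacuous for distinct
Hodge–Tate weights and is automorphic induction from ℚ(√p) for the dihedral Artin twists). Trivially
implied by Langlands. Refuters/graders: judge the route on EvenReducibleResidueClassi -/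
@[route_item "route-Langlands-MirrorPairReflection", crux]
def SectorComplement : Prop :=
  EvenReducibleResidueClassification → _root_.Langlands

/-- item stmt-Langlands-12835 · support · rank 3 · closed · proved by Summit.Langlands.Langlands.Theorems.MirrorPairReflectionMirrorCriterion.mirrorCriterion_proof (prover) · by planner
why it might fail: Mathematically only an index slip (the two endpoints are Kummer-dual to two DIFFERENT odd eigenspaces; audited on paper by the rc0 route review); formally the descent ℚ̄_p → finite E, BOTH Ribet endpoint lattices and 'trace congruence ⟹ σ̄^ss' are absent from the tree; novelty risk: folklore.
sources: Ribet1976, BellaicheChenevier2009, Berger2018, arXiv:1611.09315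
[crux] MIRROR CRITERION (card M1, normalisations pinned; hypothesis = verbatim the support item
KummerHerbrandSplitting, so that this item is exactly the NEW combination and is provable now): p
odd, σ : Γ_ℚ → GL₂(ℚ̄_p) continuous, IRREDUCIBLE, unramified outside p, residual type (a,b) with a+b
even and a ≢ b (mod p−1); m := (b−a) mod (p−1) ∈ {2,4,…,p−3}. THEN p ∣ B_m AND p ∣ B_(p−1−m). Proof
plan: (i) σ(Γ_ℚ) ⊂ GL₂(E), E/ℚ_p finite (compact image + Baire), stable lattice (tree:
exists_integralModel), reduction; the trace congruence gives σ̄^ss = ω^a ⊕ ω^b (n = 2 < p); (ii)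
Ribet1976 Prop. 2.1 / Bellaïche: σ irreducible, ω^a ≠ ω^b ⟹ the stable lattices up to homothety form
a SEGMENT whose two ENDPOINTS reduce to the non-split shapes (ω^a *; 0 ω^b) and (ω^b *; 0 ω^a),
continuous, unramified outside p; (iii) KummerHerbrandSplitting (contrapositive) at each endpoint: p
∣ B_((a−b) mod (p−1)) = B_(p−1−m) and p ∣ B_m. No hypothesis at p (σ need not be de Rham), no
Vandiver. Sanity (37; 32): type (0,32) would need 37 ∣ B_4 — false — so no irreducible σ of that
type exists although the non-split residual extension does. [deps: KummerHerbrandSplitting]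
[difficulty: L] -/
@[route_item "route-Langlands-MirrorPairReflection", crux]
def MirrorCriterion : Prop :=
  (∀ (p : ℕ) [Fact p.Prime], p ≠ 2 → ∀ (k : Type) [Field k] [CharP k p] [TopologicalSpace k] [DiscreteTopology k] (ι : ZMod p →+* k) (ρ : Literature.NumberTheory.GaloisRepresentations.FramedGaloisRep ℚ k 2) (a b : ℕ), (∀ v : IsDedekindDomain.HeightOneSpectrum (NumberField.RingOfIntegers ℚ), ((p : ℕ) : NumberField.RingOfIntegers ℚ) ∉ v.asIdeal → ρ.IsUnramifiedAt v) → Even (a + b) → ¬ ((p : ℤ) - 1 ∣ (a : ℤ) - b) → ¬ ((p : ℤ) ∣ (bernoulli ((((a : ℤ) - b) % ((p : ℤ) - 1)).toNat)).num) → (∀ g : Field.absoluteGaloisGroup ℚ, ((ρ g : Matrix.GeneralLinearGroup (Fin 2) k) : Matrix (Fin 2) (Fin 2) k) 1 0 = 0 ∧ ((ρ g : Matrix.GeneralLinearGroup (Fin 2) k) : Matrix (Fin 2) (Fin 2) k) 0 0 = (ι (PadicInt.toZMod (((Literature.NumberTheory.GaloisRepresentations.GaloisRep.cyclotomicCharacter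 ℚ p g : ℤ_[p]ˣ) : ℤ_[p])))) ^ a ∧ ((ρ g : Matrix.GeneralLinearGroup (Fin 2) k) : Matrix (Fin 2) (Fin 2) k) 1 1 = (ι (PadicInt.toZMod (((Literature.NumberTheory.GaloisRepresentations.GaloisRep.cyclotomicCharacter ℚ p g : ℤ_[p]ˣ) : ℤ_[p])))) ^ b) → ∃ P : Matrix.GeneralLinearGroup (Fin 2) k, ∀ g : Field.absoluteGaloisGroup ℚ, ((P * ρ g * P⁻¹ : Matrix.GeneralLinearGroup (Fin 2) k) : Matrix (Fin 2) (Fin 2) k) 0 1 = 0 ∧ ((P * ρ g * P⁻¹ : Matrix.GeneralLinearGroup (Fin 2) k) : Matrix (Fin 2) (Fin 2) k) 1 0 = 0) → ∀ (p : ℕ) [Fact p.Prime], p ≠ 2 → ∀ (σ : Literature.NumberTheory.GaloisRepresentations.FramedGaloisRep ℚ (PadicAlgCl p) 2) (a b : ℕ), (∀ v : IsDedekindDomain.HeightOneSpectrum (NumberField.RingOfIntegers ℚ), ((p : ℕ) : NumberField.RingOfIntegers ℚ) ∉ v.asIdeal → σ.IsUnramifiedAt v) → Even (a + b) → ¬ ((p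 : ℤ) - 1 ∣ (b : ℤ) - a) → (∀ g : Field.absoluteGaloisGroup ℚ, ‖Literature.NumberTheory.GaloisRepresentations.FramedRep.trace σ g - ((algebraMap ℚ_[p] (PadicAlgCl p) (((Literature.NumberTheory.GaloisRepresentations.GaloisRep.cyclotomicCharacter ℚ p g : ℤ_[p]ˣ) : ℤ_[p]) : ℚ_[p])) ^ a + (algebraMap ℚ_[p] (PadicAlgCl p) (((Literature.NumberTheory.GaloisRepresentations.GaloisRep.cyclotomicCharacter ℚ p g : ℤ_[p]ˣ) : ℤ_[p]) : ℚ_[p])) ^ b)‖ < 1) → Literature.NumberTheory.GaloisRepresentations.FramedRep.IsIrreducible σ → ((p : ℤ) ∣ (bernoulli ((((b : ℤ) - a) % ((p : ℤ) - 1)).toNat)).num) ∧ ((p : ℤ) ∣ (bernoulli (p - 1 - (((b : ℤ) - a) % ((p : ℤ) - 1)).toNat)).num)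

-- `MirrorCriterion` holds: proved by `Summit.Langlands.Langlands.Theorems.MirrorPairReflectionMirrorCriterion.mirrorCriterion_proof` (its module imports this route file, so no `_holds` link can be stated here).

/-- item stmt-Langlands-12837 · support · rank 9 · open · by planner
sources: Lang1990, Washington1997, Ribet1976
[support] KUMMER–HERBRAND SPLITTING (KNOWN theorem, the classical input isolated so that
MirrorCriterion is the new step; heavy in Lean because Herbrand needs Stickelberger — wanted as a
Literature named fact, see § Definition requests): p odd, k a field of characteristic p with the
discrete topology, ι : ℤ/p → k, ρ̄ : Γ_ℚ → GL₂(k) continuous, unramified outside p, upper triangular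
in the given frame with diagonal (ω^a, ω^b) (ω = ι ∘ toZMod ∘ χ_p; sub = ω^a on e₀, quotient = ω^b),
a+b even, j := (a−b) mod (p−1) ≠ 0, p ∤ B_j ⟹ ρ̄ is split (diagonal in some frame). Paper proof: the
class lies in H¹(G_(ℚ,{p,∞}), 𝔽_p(ω^j)) ⊗ k; inflation–restriction to ℚ(μ_p) and Kummer theory give
h¹(ω^j) = dim (O[1/p]^×/p)(ω^(1−j)) + d_p Cl(ω^(1−j)); for j even ≢ 0 the S-units carry no ω^(1−j)
(μ_p: ω; 1−ζ: trivial; real units: even characters), so h¹(ω^j) = d_p Cl(ℚ(μ_p))(ω^(1−j)), the ODD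
reflected eigenspace, and Herbrand (i = 1−j odd ⟹ p ∣ B_(p−i) = B_j) finishes. Checks: p = 3
vacuous; p = 5, j = 2: B_2 = 1/6, h = 1, split ✓; (37, 32): H¹(ω^32) ≠ 0 (37 ∣ B_32) while H¹(ω^4) =
0 — the asymmetry that kills even σ of type (0,32). False for odd j (h¹ − h² = 1: Eisenstein
congruences), hence the hypo -/
@[route_item "route-Langlands-MirrorPairReflection", crux]
def KummerHerbrandSplitting : Prop :=
  ∀ (p : ℕ) [Fact p.Prime], p ≠ 2 → ∀ (k : Type) [Field k] [CharP k p] [TopologicalSpace k] [DiscreteTopology k] (ι : ZMod p →+* k) (ρ : Literature.NumberTheory.GaloisRepresentations.FramedGaloisRep ℚ k 2) (a b : ℕ), (∀ v : IsDedekindDomain.HeightOneSpectrum (NumberField.RingOfIntegers ℚ), ((p : ℕ) : NumberField.RingOfIntegers ℚ) ∉ v.asIdeal → ρ.IsUnramifiedAt v) → Even (a + b) → ¬ ((p : ℤ) - 1 ∣ (a : ℤ) - b) → ¬ ((p : ℤ) ∣ (bernoulli ((((a : ℤ) - b) % ((p : ℤ) - 1)).toNat)).num) → (∀ g : Field.absoluteGaloisGroup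 ℚ, ((ρ g : Matrix.GeneralLinearGroup (Fin 2) k) : Matrix (Fin 2) (Fin 2) k) 1 0 = 0 ∧ ((ρ g : Matrix.GeneralLinearGroup (Fin 2) k) : Matrix (Fin 2) (Fin 2) k) 0 0 = (ι (PadicInt.toZMod (((Literature.NumberTheory.GaloisRepresentations.GaloisRep.cyclotomicCharacter ℚ p g : ℤ_[p]ˣ) : ℤ_[p])))) ^ a ∧ ((ρ g : Matrix.GeneralLinearGroup (Fin 2) k) : Matrix (Fin 2) (Fin 2) k) 1 1 = (ι (PadicInt.toZMod (((Literature.NumberTheory.GaloisRepresentations.GaloisRep.cyclotomicCharacter ℚ p g : ℤ_[p]ˣ) : ℤ_[p])))) ^ b) → ∃ P : Matrix.GeneralLinearGroup (Fin 2) k, ∀ g : Field.absoluteGaloisGroup ℚ, ((P * ρ g * P⁻¹ : Matrix.GeneralLinearGroup (Fin 2) k) : Matrix (Fin 2) (Fin 2) k) 0 1 = 0 ∧ ((P * ρ g * P⁻¹ : Matrix.GeneralLinearGroup (Fin 2) k) : Matrix (Fin 2) (Fin 2) k) 1 0 = 0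

/-- item stmt-Langlands-12838 · support · rank 9 · open · by planner
sources: Washington1997, Berger2018
[support] SCALAR RESIDUE IS ABELIAN (the card's flagged case M5, settled for conductor p^∞): p odd,
σ : Γ_ℚ → GL₂(ℚ̄_p) unramified outside p with residual type (a,b), a ≡ b (mod p−1) ⟹ σ is reducible.
Proof: twist by the Teichmüller lift of ω^(−a) (finite order, unramified outside p); the image then
reduces into a unipotent group, hence is pro-p, so the twist factors through the maximal pro-p
quotient of G_(ℚ,{p,∞}), which is pro-cyclic (≅ ℤ_p: Hom(G_(ℚ,{p,∞}), ℤ/p) is 1-dimensional by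
Kronecker–Weber, p odd); an abelian image has a common eigenvector over ℚ̄_p. Lean debts: Baire
descent to GL₂(E), twisting a FramedGaloisRep by a character, the KroneckerWeber named facts of the
tree. p = 2 rightly excluded (Hom(G_(ℚ,{2,∞}), ℤ/2) has dimension 2; card one-relator-worlds lives
there). [difficulty: M] -/
@[route_item "route-Langlands-MirrorPairReflection", crux]
def ScalarResidueReducible : Prop :=
  ∀ (p : ℕ) [Fact p.Prime], p ≠ 2 → ∀ (σ : Literature.NumberTheory.GaloisRepresentations.FramedGaloisRep ℚ (PadicAlgCl p) 2) (a b : ℕ), (∀ v : IsDedekindDomain.HeightOneSpectrum (NumberField.RingOfIntegers ℚ), ((p : ℕ) : NumberField.RingOfIntegers ℚ) ∉ v.asIdeal → σ.IsUnramifiedAt v) → ((p : ℤ) - 1 ∣ (b : ℤ) - a) → (∀ g : Field.absoluteGaloisGroup ℚ, ‖Literature.NumberTheory.GaloisRepresentations.FramedRep.trace σ g - ((algebraMap ℚ_[p] (PadicAlgCl p) (((Literature.NumberTheory.GaloisRepresentations.GaloisRep.cyclotomicCharacter ℚ p g : ℤ_[p]ˣ) : ℤ_[p]) : ℚ_[p]))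 ^ a + (algebraMap ℚ_[p] (PadicAlgCl p) (((Literature.NumberTheory.GaloisRepresentations.GaloisRep.cyclotomicCharacter ℚ p g : ℤ_[p]ˣ) : ℤ_[p]) : ℚ_[p])) ^ b)‖ < 1) → ¬ Literature.NumberTheory.GaloisRepresentations.FramedRep.IsIrreducible σ

/-- item stmt-Langlands-12839 · support · rank 9 · open · by planner
sources: HartHarveyOng2017, BuhlerHarvey2011, Washington1997
[support] THE STRONG VACUITY THEOREM BELOW 2^10 (hypothesis = verbatim KummerHerbrandSplitting): for
every odd prime p < 1024, every continuous σ : Γ_ℚ → GL₂(ℚ̄_p) unramified outside p with reducible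
residue (type (a,b)) and even (a+b even) is REDUCIBLE — 'no even irreducible 2-dimensional p-adic
Galois representation of conductor p^∞ with reducible reduction exists, geometric or not', new at
each of the 81 irregular pairs with p < 1024. Proof = MirrorCriterion (fed the hypothesis) +
ScalarResidueReducible + the finite check that no prime p < 1024 has a mirror pair {k, p−1−k} of
irregular indices (self-pairs included), kernel-decidable through Σ_(a<p) a^k ≡ p·B_k (mod p²) or
one Bernoulli-mod-p non-divisibility certificate per unordered pair; verified independently twice
(gen-0 planner scan p < 8192; refuter scan p < 1100: 64 irregular primes / 81 pairs below 1024, no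
mirror pair, no self-index). Bound 1024 is for kernel feasibility, not truth; restate higher once a
verified checker lands. [difficulty: M] -/
@[route_item "route-Langlands-MirrorPairReflection"]
def VoidBelow1024 : Prop :=
  (∀ (p : ℕ) [Fact p.Prime], p ≠ 2 → ∀ (k : Type) [Field k] [CharP k p] [TopologicalSpace k] [DiscreteTopology k] (ι : ZMod p →+* k) (ρ : Literature.NumberTheory.GaloisRepresentations.FramedGaloisRep ℚ k 2) (a b : ℕ), (∀ v : IsDedekindDomain.HeightOneSpectrum (NumberField.RingOfIntegers ℚ), ((p : ℕ) : NumberField.RingOfIntegers ℚ) ∉ v.asIdeal → ρ.IsUnramifiedAt v) → Even (a + b) → ¬ ((p : ℤ) - 1 ∣ (a : ℤ) - b) → ¬ ((p : ℤ) ∣ (bernoulli ((((a : ℤ) - b) % ((p : ℤ) - 1)).toNat)).num) → (∀ g : Field.absoluteGaloisGroup ℚ, ((ρ g : Matrix.GeneralLinearGroup (Fin 2) k) : Matrix (Fin 2) (Fin 2) k) 1 0 = 0 ∧ ((ρ g : Matrix.GeneralLinearGroup (Fin 2) k) : Matrix (Fin 2) (Fin 2) k) 0 0 = (ι (PadicInt.toZMod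 (((Literature.NumberTheory.GaloisRepresentations.GaloisRep.cyclotomicCharacter ℚ p g : ℤ_[p]ˣ) : ℤ_[p])))) ^ a ∧ ((ρ g : Matrix.GeneralLinearGroup (Fin 2) k) : Matrix (Fin 2) (Fin 2) k) 1 1 = (ι (PadicInt.toZMod (((Literature.NumberTheory.GaloisRepresentations.GaloisRep.cyclotomicCharacter ℚ p g : ℤ_[p]ˣ) : ℤ_[p])))) ^ b) → ∃ P : Matrix.GeneralLinearGroup (Fin 2) k, ∀ g : Field.absoluteGaloisGroup ℚ, ((P * ρ g * P⁻¹ : Matrix.GeneralLinearGroup (Fin 2) k) : Matrix (Fin 2) (Fin 2) k) 0 1 = 0 ∧ ((P * ρ g * P⁻¹ : Matrix.GeneralLinearGroup (Fin 2) k) : Matrix (Fin 2) (Fin 2) k) 1 0 = 0) → ∀ (p : ℕ) [Fact p.Prime], p ≠ 2 → p < 1024 → ∀ (σ : Literature.NumberTheory.GaloisRepresentations.FramedGaloisRep ℚ (PadicAlgCl p) 2) (a b : ℕ), (∀ v : IsDedekindDomain.HeightOneSpectrum (NumberField.RingOfIntegers ℚ), ((p : ℕ) : NumberField.RingOfIntegers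 ℚ) ∉ v.asIdeal → σ.IsUnramifiedAt v) → Even (a + b) → (∀ g : Field.absoluteGaloisGroup ℚ, ‖Literature.NumberTheory.GaloisRepresentations.FramedRep.trace σ g - ((algebraMap ℚ_[p] (PadicAlgCl p) (((Literature.NumberTheory.GaloisRepresentations.GaloisRep.cyclotomicCharacter ℚ p g : ℤ_[p]ˣ) : ℤ_[p]) : ℚ_[p])) ^ a + (algebraMap ℚ_[p] (PadicAlgCl p) (((Literature.NumberTheory.GaloisRepresentations.GaloisRep.cyclotomicCharacter ℚ p g : ℤ_[p]ˣ) : ℤ_[p]) : ℚ_[p])) ^ b)‖ < 1) → ¬ Literature.NumberTheory.GaloisRepresentations.FramedRep.IsIrreducible σ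

-- item stmt-Langlands-14073 · support · rank 9 · open · by planner — informal only, no Lean statement yet:
--   [support] MIRROR SCAN TO 2^31 (kit job; the card's M3 and this route's CHEAPEST FALSIFIER; informal
--   until run, then set-signature or attach the hit): take the complete table of irregular pairs (p, k)
--   for p < 2^31 (HartHarveyOng2017 §1: hosted at D. Harvey's page; 105,097,564 odd primes,
--   Poisson(1/2)-distributed indices; BuhlerHarvey2011 to 163·10^6 as fallback) and list every prime
--   with two irregular indices k, k' satisfying k + k' = p − 1, INCLUDING k = k' = (p−1)/2 (that case is
--   an Ankeny–Artin–Chowla counterexample: none expected below 2·10^11,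
--   VanderpoortenTerieleWilliams2000). Expected nu

/-- item stmt-Langlands-14483 · support · rank 9 · closed · proved by Summit.Langlands.Langlands.Theorems.MirrorPairReflectionCruxesToClassification.cruxesToClassification (prover) · by planner
sources: Ribet1976, Berger2018, AnkenyArtinChowla1952
[support] GLUE TO THE TARGET (rev 3; badge repair of `route.target-unreachable`: the item that
CONCLUDES the route's target X = EvenReducibleResidueClassification). KummerHerbrandSplitting →
MirrorCriterion → NonSelfMirrorReducible → SelfMirrorDihedral → ScalarResidueReducible →
EvenReducibleResidueClassification: the case analysis by which the two cruxes
(NonSelfMirrorReducible, SelfMirrorDihedral) and the supports (MirrorCriterion fed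
KummerHerbrandSplitting, ScalarResidueReducible) give the classification of the even, residually
reducible, conductor-p^∞ sector; with SectorComplement (X → Langlands) the chain cruxes → X →
Statement is itemised, while the deciding theorem `closes` (native OK, unchanged) keeps deriving X
inline. PROVABLE NOW — proof = the body of `closes` after `refine hC ?_` (planner folder
Sketch.lean, lean check rc 0, 0 sorries, attached as candidate proof): given σ even of residual type
(a,b), irreducible: if (p−1) ∣ (b−a), ScalarResidueReducible contradicts irreducibility; else
MirrorCriterion yields p ∣ B_m ∧ p ∣ B_(p−1−m), m = (b−a) mod (p−1); if ¬ (p−1) ∣ 2(b−a),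
NonSelfMirrorReducible contradicts; else Int.emod arithmetic gives 2m = p−1, parity of a+b and -/
@[route_item "route-Langlands-MirrorPairReflection"]
def CruxesToClassification : Prop :=
  KummerHerbrandSplitting → MirrorCriterion → NonSelfMirrorReducible → SelfMirrorDihedral → ScalarResidueReducible → EvenReducibleResidueClassification

-- `CruxesToClassification` holds: proved by `Summit.Langlands.Langlands.Theorems.MirrorPairReflectionCruxesToClassification.cruxesToClassification` (its module imports this route file, so no `_holds` link can be stated here).

/-- item stmt-Langlands-12841 · assembly · rank 1 · closed · proved by Summit.Langlands.Langlands.Theorems.mirrorPairReflection_assembly_proof (prover) · by planner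
sources: Ribet1976, Berger2018, BuzzardGeeLMS2014
[assembly] KummerHerbrandSplitting → MirrorCriterion → NonSelfMirrorReducible → SelfMirrorDihedral →
ScalarResidueReducible → SectorComplement → Langlands (the cruxes give the sector classification by
case analysis + integer arithmetic; SectorComplement names the rest of the summit). -/
@[route_item "route-Langlands-MirrorPairReflection"]
def Assembly : Prop :=
  KummerHerbrandSplitting → MirrorCriterion → NonSelfMirrorReducible → SelfMirrorDihedral → ScalarResidueReducible → SectorComplement → _root_.Langlands

-- `Assembly` holds: proved by `Summit.Langlands.Langlands.Theorems.mirrorPairReflection_assembly_proof` (its module imports this route file, so no `_holds` link can be stated here).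

/-! D-0027 §2.1 — DECIDING THEOREM (planner-authored via `route open/edit --closes-file`; by planner-plancard-Langlands-Langlands-conducto-96b98e8b-g2-0 2026-08-15T18:59:11Z):
its hypotheses are this route's items and its conclusion the sub-problem Statement (glue_lint), and it elaborates with this file. -/

@[closes "route-Langlands-MirrorPairReflection"] theorem closes (hK : KummerHerbrandSplitting) (hM : MirrorCriterion) (hN : NonSelfMirrorReducible)
    (hS : SelfMirrorDihedral) (hR : ScalarResidueReducible) (hC : SectorComplement) : _root_.Langlands := by
  refine hC ?_
  intro p _ hp σ a b hU hE hT hI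
  have hp3 : 3 ≤ p := by
    have h2 := (Fact.out : p.Prime).two_le
    omega
  -- case 1: scalar residue (a ≡ b mod p-1) is reducible
  by_cases h1 : ((p : ℤ) - 1 ∣ (b : ℤ) - a)
  · exact absurd hI (hR p hp σ a b hU h1 hT)
  -- otherwise the mirror criterion gives p ∣ B_m and p ∣ B_{p-1-m}
  obtain ⟨d1, d2⟩ := hM hK p hp σ a b hU hE h1 hT hI
  -- case 2: a genuine (non-self) mirror pair is reducible
  by_cases h2 : ((p : ℤ) - 1 ∣ 2 * ((b : ℤ) - a))
  swap
  · exact absurd hI (hN p hp σ a b hU hE h2 hT d1 d2)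
  -- case 3: self-mirror index; arithmetic: m = (p-1)/2 and p ≡ 1 (mod 4)
  set q : ℤ := (p : ℤ) - 1 with hq
  set m : ℤ := ((b : ℤ) - a) % q with hm
  set X : ℤ := ((b : ℤ) - a) / q with hX
  have hq0 : 0 < q := by omega
  have hm0 : 0 ≤ m := Int.emod_nonneg _ (by omega)
  have hmq : m < q := Int.emod_lt_of_pos _ hq0
  have hfm : m + q * X = (b : ℤ) - a := Int.emod_add_mul_ediv _ _
  have hm_ne : m ≠ 0 := fun h0 => h1 (Int.dvd_of_emod_eq_zero h0)
  obtain ⟨e, he⟩ := h2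
  have h2m : 2 * m = q * (e - 2 * X) := by
    rw [mul_sub, ← he]
    linarith
  have hc : e - 2 * X = 1 := by
    set c := e - 2 * X with hcdef
    have hmpos : 0 < m := lt_of_le_of_ne hm0 (Ne.symm hm_ne)
    rcases le_or_gt c 0 with hc0 | hc0
    · have : q * c ≤ 0 := mul_nonpos_iff.mpr (Or.inl ⟨hq0.le, hc0⟩)
      linarith
    · rcases le_or_gt c 1 with hc1 | hc1
      · omega
      · have : q * 2 ≤ q * c := mul_le_mul_of_nonneg_left (by omega) hq0.le
        linarith
  have h2mq : 2 * m = q := by rw [h2m, hc, mul_one]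
  obtain ⟨k, hk⟩ := (Nat.Prime.eq_two_or_odd' (Fact.out : p.Prime)).resolve_left hp
  obtain ⟨r, hr⟩ := hE
  have hkZ : (p : ℤ) = 2 * k + 1 := by exact_mod_cast hk
  have hrZ : (a : ℤ) + b = r + r := by exact_mod_cast hr
  obtain ⟨t, ht⟩ : ∃ t : ℤ, (k : ℤ) * X = t := ⟨_, rfl⟩
  have hqk : q = 2 * k := by omega
  have hqX : q * X = 2 * t := by rw [hqk, mul_assoc, ht]
  have hbat : (b : ℤ) - a = 2 * t + m := by linarith
  have hidx : (((b : ℤ) - a) % ((p : ℤ) - 1)).toNat = (p - 1) / 2 := by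
    show m.toNat = (p - 1) / 2
    omega
  have hB : (p : ℤ) ∣ (bernoulli ((p - 1) / 2)).num := by
    rw [← hidx]; exact d1
  refine ⟨by omega, ?_, hB, ?_⟩
  · show 2 * m.toNat = p - 1
    omega
  · exact hS p hp σ a b hU ⟨r, hr⟩ h1 ⟨e, he⟩ hT hB hI

end Summit.Langlands.Langlands.Theses.MirrorPairReflection
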